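import Literature.AlgebraicGeometry.HodgeTheory.SupportedClassesOfChowZeroSupported
import Literature.AlgebraicGeometry.HodgeTheory.CorrespondenceActionHodgeClassesOfGysinResolved
import Literature.AlgebraicGeometry.HodgeTheory.AndreottiFrankelAffine
import Literature.AlgebraicGeometry.HodgeTheory.ComplexOrientationDegreeFormulaHolds
import Literature.AlgebraicTopology.SingularHomology.UniversalCoefficientsField
import HarnessLib

/-!
# `CH₀(X)` supported in dimension `≤ d` forces geometric coniveau `≥ 1` of `Hˡ(X)` for EVERY `l > d`

Family `hodge`, layer `Literature/AlgebraicGeometry/HodgeTheory` (theorems only; no definition, no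
named fact). Sequel of `SupportedClassesOfChowZeroSupported`, which proves
`N¹ Hˡ(X(ℂ); ℂ) = Hˡ(X(ℂ); ℂ)` for `l > 2d` when `CH₀(X)` is supported on a closed algebraic subset
of dimension `≤ d` (S. Bloch, V. Srinivas, Amer. J. Math. 105 (1983), Thm. 1 and its proof;
C. Voisin, *Hodge Theory and Complex Algebraic Geometry II* (2003), proof of Thm. 10.17,
(10.5)–(10.10)) and records the range `2d ≥ l > d` as NOT covered ("`j̃^*c ∈ Hˡ(X̃'(ℂ))` need not
vanish and the coniveau of `[Z̃'']^*(j̃^*c)` requires hard Lefschetz on `X̃'`"). This file closes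
that range WITHOUT hard Lefschetz, by the affine Lefschetz theorem of Andreotti–Frankel instead
(Voisin II Thm. 1.22, PROVED in the tree: `AffineCoordinates.isZero_singularHomology_setOf_pt_mem_affineOpen`):

* `restrictCompl_compl_eq_zero_of_isAffineOpen` — on a smooth projective `X₁` of dimension `d'`,
  every class of `Hˡ(X₁(ℂ); ℂ)`, `l > d'`, vanishes on the complex points over ANY affine open `U`
  (`H_l(U(ℂ)) = 0` by Andreotti–Frankel, and universal coefficients over the field `ℂ`); so such a
  class dies off the complement of every affine open.
* `GysinFormalism.corrAct_primeCycle_mem_supportedClasses_one_of_height_snd_lt` — **(10.9) in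
  coniveau form, all classes**: a prime `n`-dimensional correspondence `V = closure {z} ⊆ X ⊗ X` with
  `dim pr₂(z) < l` maps `Hˡ(X(ℂ); ℂ)` into `N¹ Hˡ(X(ℂ); ℂ)`. Proof: `[V]^* = [Ṽ]^* ∘ j̃^*` through a
  projective resolution `j̃ : X₁ → closure {pr₂ z}` (projective Hironaka and the lifting of prime
  cycles, both PROVED: `Resolution.Hironaka1964_projective_holds`,
  `Motives.primeCycle_lift_of_isBirational_holds`); then `[Ṽ]^*(c₁) = q_*(p^* c₁)` through a resolution
  `τ : Ṽ' → Ṽ ⊆ X ⊗ X₁` of the lifted prime cycle (`GysinFormalism.corrActGen_primeCycle_eq`,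
  `p = τ ≫ pr_{X₁}`, `q = τ ≫ pr_X`); `c₁ = j̃^*c` dies off the complement of an affine open `U ∋ p(ξ)`
  (`ξ` the generic point of `Ṽ'`), so `p^*c₁` dies off the PROPER closed `p⁻¹(X₁ ∖ U) ⊊ Ṽ'`, i.e.
  `p^*c₁ ∈ N¹Hˡ(Ṽ')`, and the Gysin morphism `q_*` (`dim Ṽ' = dim X`) maps `N¹` into `N¹`
  (`GysinFormalism.gysin_mem_supportedClasses`).
* `GysinFormalism.supportedClasses_eq_top_of_chowZeroSupportedInDimLE_of_lt` — **for `X` smooth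
  projective of dimension `n` with `CH₀(X)` supported on a closed `W` of dimension `≤ d`, and every
  `l > d`, `N¹ Hˡ(X(ℂ); ℂ) = Hˡ(X(ℂ); ℂ)`**, granted a Gysin / cycle-class formalism `G` (parameter):
  `m c = [Z']^*c + [Z'']^*c` from the decomposition of the diagonal
  (`Barriers.HodgeConjecture.BlochSrinivas1983_decompositionOfTheDiagonal_holds`, Cor. 10.21), `[Z']^*c ∈ N¹`
  ((10.8)), `[Z'']^*c ∈ N¹` component by component (previous item); `∃ W` form
  `…_of_hasChowZeroSupportedInDimLE_of_lt`.
* `supportedClasses_eq_top_of_hasChowZeroSupportedInDimLE_of_lt` — the same with `G` DISCHARGED by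
  the unconditional complex-orientation formalism
  (`exists_gysinFormalism_isGysinHodgeCompatible_complexOrientation_holds`): an hypothesis-free theorem of the
  tree. In particular: a smooth projective THREEFOLD whose `CH₀` is supported on a surface (e.g. a
  uniruled threefold) has `H³ = N¹H³` — the known regime of Grothendieck's amended GHC(3,1)
  (`supportedClasses_three_one_eq_top_of_hasChowZeroSupportedInDimLE_two`).

## References

* [BlochSrinivas1983] S. Bloch, V. Srinivas, Remarks on correspondences and algebraic cycles,
  Amer. J. Math. 105 (1983) 1235–1253, Thm. 1 and its proof (the decomposition `NΔ = Γ₁ + Γ₂` and its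
  action on cohomology).
* [VoisinHodgeII2003] C. Voisin, Hodge Theory and Complex Algebraic Geometry II (2003), proof of
  Thm. 10.17 ((10.5)–(10.10)), Cor. 10.21, Lemma 9.18, and §1.2.2 Thm. 1.22 (Andreotti–Frankel).
* [HatcherAT2002] A. Hatcher, Algebraic Topology (2002), §3.1 Thm. 3.2 (universal coefficients).
* [Kollar2007] J. Kollár, Lectures on Resolution of Singularities (2007), Thm. 3.27.
* [GrothendieckTopology1969] A. Grothendieck, Hodge's general conjecture is false for trivial
  reasons, Topology 8 (1969), §1 (the coniveau filtration `N^p`).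
-/

noncomputable section

open CategoryTheory CategoryTheory.Limits AlgebraicGeometry MonoidalCategory CartesianMonoidalCategory

namespace Literature.AlgebraicGeometry.HodgeTheory

open Literature.AlgebraicGeometry.Motives Literature.Barriers.HodgeConjecture
open Literature.AlgebraicTopology.SingularHomology

section HodgeTheory

variable {n : ℕ} {X : SchemeOver ℂ}

/-! ### Andreotti–Frankel in cohomology: classes above the dimension die off every affine open -/

/-- **Classes of degree `l > dim` die off the complement of every affine open** (Andreotti–Frankel,
Voisin II Thm. 1.22, in cohomology): for `X₁` smooth projective of dimension `d'`, an affine open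
`U ⊆ X₁` and `l ≥ d' + 1`, the complex points over `U` have `H_l = 0`
(`AffineCoordinates.isZero_singularHomology_setOf_pt_mem_affineOpen`), hence `Hˡ = 0` over `ℂ`, so every
`c ∈ Hˡ(X₁(ℂ); ℂ)` restricts to `0` on `(X₁ ∖ (X₁ ∖ U))(ℂ) = U(ℂ)`.
[cite: VoisinHodgeII2003, §1.2.2 Thm. 1.22 (PDF p. 59)] -/
theorem restrictCompl_compl_eq_zero_of_isAffineOpen {d' : ℕ} {X₁ : SchemeOver ℂ}
    (hX₁ : IsSmoothProjective d' X₁) {U : X₁.left.Opens} (hU : IsAffineOpen U) {l : ℕ}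
    (hl : d' + 1 ≤ l) (c : complexBetti X₁ l) :
    complexBetti.restrictCompl X₁ ((U : Set X₁.left)ᶜ) l c = 0 := by
  haveI := hX₁.smoothOfRelativeDimension
  haveI : LocallyOfFiniteType X₁.hom := locallyOfFiniteType_of_isSmoothProjective hX₁
  have h0 : IsZero (singularHomology ℂ ℂ ↥{P : ComplexPoints X₁ | P.pt ∈ (U : Set X₁.left)} l) :=
    AffineCoordinates.isZero_singularHomology_setOf_pt_mem_affineOpen X₁ _ hU hl
  have hset : {P : ComplexPoints X₁ | P.pt ∈ (U : Set X₁.left)} =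
      {P : ComplexPoints X₁ | P.pt ∉ (U : Set X₁.left)ᶜ} := by
    ext P
    simp
  let e : ↥{P : ComplexPoints X₁ | P.pt ∈ (U : Set X₁.left)} ≃ₜ
      complexPointsCompl X₁ ((U : Set X₁.left)ᶜ) :=
    Homeomorph.setCongr hset
  have h1 : IsZero (singularHomology ℂ ℂ (complexPointsCompl X₁ ((U : Set X₁.left)ᶜ)) l) :=
    h0.of_iso ((HomologicalComplex.homologyFunctor _ _ l).mapIso
      (singularChainComplex.mapHomeomorph ℂ ℂ e)).symm
  -- universal coefficients over the field `ℂ`: `H_l = 0` ⟹ `Hˡ = 0` (Hatcher Thm. 3.2; the tree's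
  -- `kroneckerPairing_bijective_of_field`; cf. the Summits-side `linearSystemTorelli_isZero_…`)
  haveI := ModuleCat.subsingleton_of_isZero h1
  haveI : Subsingleton (singularHomology ℂ ℂ (complexPointsCompl X₁ ((U : Set X₁.left)ᶜ)) l →ₗ[ℂ] ℂ) :=
    ⟨fun f g ↦ LinearMap.ext fun x ↦ by rw [Subsingleton.elim x 0, map_zero, map_zero]⟩
  haveI : Subsingleton (singularCohomology ℂ ℂ (complexPointsCompl X₁ ((U : Set X₁.left)ᶜ)) l) :=
    (kroneckerPairing_bijective_of_field ℂ _ l).1.subsingleton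
  exact Subsingleton.elim _ _

/-! ### (10.9) in coniveau form: the second-support case for all classes above the dimension -/

/-- **(Coniveau case of (10.9), all classes.)** If `V = closure {z} ⊆ X ⊗ X` is `n`-dimensional and
`dim pr₂(z) < l`, then `[V]^*` maps `Hˡ(X(ℂ); ℂ)` into `N¹ Hˡ(X(ℂ); ℂ)`: `[V]^*c = [Ṽ]^*(j̃^*c)`
through a projective resolution `j̃ : X₁ → closure {pr₂ z}` (Voisin II (10.9); projective Hironaka
and the lifting of prime cycles, PROVED in the tree); `[Ṽ]^*(c₁) = q_*(p^*c₁)` through a resolution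
of the lifted prime cycle (`GysinFormalism.corrActGen_primeCycle_eq`); `c₁ = j̃^*c` dies off the
complement of an affine open `U` of `X₁` containing the image of the generic point
(Andreotti–Frankel, `l > dim X₁`), so `p^*c₁` is supported on a PROPER closed subset, of codimension
`≥ 1`, and `q_*` preserves `N¹` (equal dimensions). [cite: VoisinHodgeII2003, proof of Thm. 10.17 (10.9) and Thm. 1.22]
[cite: BlochSrinivas1983, Thm. 1 (proof)] [cite: Kollar2007, Thm. 3.27] -/
theorem GysinFormalism.corrAct_primeCycle_mem_supportedClasses_one_of_height_snd_lt
    (G : GysinFormalism) (hX : IsSmoothProjective n X) (z : ↥(X ⊗ X).left)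
    (hz : primeCycle z ∈ cyclesOfDim (X ⊗ X).left n) (hzn : Order.height z = n) {l : ℕ}
    (hlt : Order.height ((snd X X).left.base z) < (l : ℕ∞)) (c : complexBetti X l) :
    G.corrAct hX hX l ⟨primeCycle z, hz⟩ c ∈ supportedClasses X l 1 := by
  classical
  set x' := (snd X X).left.base z with hx'
  set X₀ := ClosedSubvariety.ofPoint X.left x' with hX₀
  obtain ⟨d', X₁, π, hX₁, hπ, hdim⟩ :=
    exists_resolution_ofPoint Resolution.Hironaka1964_projective_holds hX x'
  -- `d' = dim closure {x'} < l`
  have hd'l : d' + 1 ≤ l := by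
    rw [hdim] at hlt
    have : d' < l := by exact_mod_cast hlt
    omega
  have hXX₁ := IsSmoothProjective.tensor_holds hX hX₁
  haveI := noetherianSpace_of_isSmoothProjective hXX₁
  set j : X₁ ⟶ X := π ≫ X₀.ιOver with hj
  -- lift `[closure z]` along `X ◁ j`
  obtain ⟨z₁, hz₁, hmap⟩ := primeCycle_lift_of_isBirational_holds hX hX hX₁ X₀ j π.left rfl hπ z
    (by rw [ClosedSubvariety.genericPoint_ofPoint])
  have hz₁n' : Order.height z₁ = n := by rw [hz₁, hzn]
  have hz₁n : primeCycle z₁ ∈ cyclesOfDim (X ⊗ X₁).left n := primeCycle_mem_cyclesOfDim hz₁n'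
  have hpush : cyclesOfDimMap n (X ◁ j).left ⟨primeCycle z₁, hz₁n⟩ = ⟨primeCycle z, hz⟩ :=
    Subtype.ext hmap
  -- (10.9): `[V]^*c = [Ṽ]^*(j^*c)`
  rw [← hpush, G.corrAct_eq_corrActGen,
    G.corrActGen_cyclesOfDimMap_whiskerLeft hX hX hX₁ j rfl (show n + d' = n + d' from rfl) rfl
      (show l + 2 * d' = l + 2 * d' from rfl) ⟨primeCycle z₁, hz₁n⟩,
    LinearMap.comp_apply]
  set c₁ : complexBetti X₁ l := (complexBetti.map j l).hom c with hc₁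
  -- resolve the lifted prime cycle: `[Ṽ]^*(c₁) = q_*(p^* c₁)`
  obtain ⟨V, τ, η, hV, hηg, hηn, hτ⟩ :=
    exists_resolution_primeCycle Resolution.Hironaka1964_projective_holds hXX₁ z₁ hz₁n'
  haveI : QuasiCompact τ.left := by
    haveI := isProper_left_of_isSmoothProjective hV hXX₁ τ
    infer_instance
  have hη : primeCycle η ∈ cyclesOfDim V.left n := primeCycle_mem_cyclesOfDim hηn
  have hτ' : cyclesOfDimMap n τ.left ⟨primeCycle η, hη⟩ = ⟨primeCycle z₁, hz₁n⟩ := Subtype.ext hτ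
  rw [G.corrActGen_primeCycle_eq hX hX₁ (show n + d' = n + d' from rfl)
    (show l + 2 * d' = l + 2 * d' from rfl) z₁ hz₁n hV τ η hηg hη hτ' c₁]
  -- `q_*` maps `N¹ Hˡ(Ṽ)` into `N¹ Hˡ(X)` (equal dimensions)
  refine G.gysin_mem_supportedClasses hV hX (τ ≫ fst X X₁) _ (r := 1) (s := 1) (add_comm 1 n).le ?_
  -- an affine open `U ∋ p(ξ)` of `X₁`, `p = τ ≫ pr_{X₁}`, `ξ` the generic point of `Ṽ`
  haveI : IsIntegral V.left := IsSmoothProjective.isIntegral_holds hV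
  set p : V ⟶ X₁ := τ ≫ snd X X₁ with hp
  obtain ⟨U, hU, hξU, -⟩ := exists_isAffineOpen_mem_and_subset (X := X₁.left)
    (x := p.left.base (genericPoint V.left)) (U := ⊤) trivial
  -- `c₁` dies off `X₁ ∖ U`, hence `p^* c₁` dies off `p⁻¹(X₁ ∖ U)`
  have hc₁U : complexBetti.restrictCompl X₁ ((U : Set X₁.left)ᶜ) l c₁ = 0 :=
    restrictCompl_compl_eq_zero_of_isAffineOpen hX₁ hU hd'l c₁
  have hpc₁ := complexBetti.restrictCompl_map_eq_zero p hc₁U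
  -- `p⁻¹(X₁ ∖ U)` is a proper closed subset of the irreducible `Ṽ`
  have hclosed : IsClosed (p.left.base ⁻¹' (U : Set X₁.left)ᶜ) :=
    (U.isOpen.isClosed_compl).preimage p.left.continuous
  have hne : p.left.base ⁻¹' (U : Set X₁.left)ᶜ ≠ Set.univ := by
    intro h
    have hξ : genericPoint V.left ∈ p.left.base ⁻¹' (U : Set X₁.left)ᶜ := h ▸ Set.mem_univ _
    exact hξ hξU
  exact mem_supportedClasses_of_restrictCompl_eq_zero hclosed
    (one_le_coheight_of_isClosed_of_ne_univ hV hclosed hne) hpc₁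

/-! ### `CH₀(X)` supported in dimension `≤ d` ⟹ `N¹ Hˡ = Hˡ` for every `l > d` -/

/-- **`CH₀(X)` supported in dimension `≤ d` ⟹ `N¹ Hˡ(X(ℂ); ℂ) = Hˡ(X(ℂ); ℂ)` for every `l > d`**
(granted a Gysin / cycle-class formalism `G`). From `mΔ_X ∼_rat Z' + Z''` with `Z' ⊂ T × X`,
`T ⊊ X` closed, `Z'' ⊂ X × W` (Cor. 10.21, `BlochSrinivas1983_decompositionOfTheDiagonal_holds`):
`m c = [Z']^*c + [Z'']^*c` (Lemma 9.18, `[Δ_X]^* = Id`); `[Z']^*c` vanishes off `T` ((10.8)); every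
component of `Z''` lies over a point of `W`, of dimension `≤ d < l`, so `[Z'']^*c ∈ N¹`
(`GysinFormalism.corrAct_primeCycle_mem_supportedClasses_one_of_height_snd_lt`); `m ≠ 0` is invertible
in `ℂ`. Extends `GysinFormalism.supportedClasses_eq_top_of_chowZeroSupportedInDimLE` (`l > 2d`) to the
full range `l > d`. [cite: BlochSrinivas1983, Thm. 1 (proof)]
[cite: VoisinHodgeII2003, proof of Thm. 10.17 ((10.5)–(10.10)), Cor. 10.21 and Thm. 1.22] -/
theorem GysinFormalism.supportedClasses_eq_top_of_chowZeroSupportedInDimLE_of_lt (G : GysinFormalism)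
    (hX : IsSmoothProjective n X) {W : Set X.left} {d : ℕ} (hW : ChowZeroSupportedInDimLE X W d)
    {l : ℕ} (hdl : d < l) : supportedClasses X l 1 = ⊤ := by
  classical
  obtain ⟨δ, hδ⟩ := exists_isGenericPoint_range_diagonal hX
  obtain ⟨m, hm, T, hT, hTne, Z', hZ', Z'', hZ'', hZ'T, hZ''W, hrat⟩ :=
    BlochSrinivas1983_decompositionOfTheDiagonal_holds.of_chowZeroSupportedInDimLE hX hW δ hδ
  -- `Δ` is an `n`-cycle
  have hn : primeCycle δ ∈ cyclesOfDim (X ⊗ X).left n := primeCycle_diagonal_mem_cyclesOfDim hX hδ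
  have hrat' : IsRationallyEquivalent
      ((m • ⟨primeCycle δ, hn⟩ : ↥(cyclesOfDim (X ⊗ X).left n)) : AlgebraicCycle (X ⊗ X).left ℤ)
      ((⟨Z', hZ'⟩ + ⟨Z'', hZ''⟩ : ↥(cyclesOfDim (X ⊗ X).left n)) : AlgebraicCycle (X ⊗ X).left ℤ) n := by
    rw [AddSubgroup.coe_add]
    exact hrat
  -- (10.5): `m • c = [Z']^*c + [Z'']^*c`
  have hact := G.corrAct_congr hX hX l hrat'
  rw [map_nsmul, map_add, G.corrAct_primeCycle_diagonal hX l δ hδ hn] at hact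
  refine eq_top_iff.2 fun c _ ↦ ?_
  have hmc : (m : ℂ) • c = G.corrAct hX hX l ⟨Z', hZ'⟩ c + G.corrAct hX hX l ⟨Z'', hZ''⟩ c := by
    have h := LinearMap.congr_fun hact c
    simp only [LinearMap.smul_apply, LinearMap.id_apply, LinearMap.add_apply] at h
    rw [← h, Nat.cast_smul_eq_nsmul ℂ m c]
  have hmem : (m : ℂ) • c ∈ supportedClasses X l 1 := by
    rw [hmc]
    refine add_mem ?_ ?_
    · -- (10.8): `[Z']^*c` is supported on `T ⊊ X`
      exact G.corrAct_mem_supportedClasses_of_fst_mem hX l hT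
        (one_le_coheight_of_isClosed_of_ne_univ hX hT hTne) hZ'T c
    · -- (10.9), coniveau form: `[Z'']^*c ∈ N¹`, component by component
      refine G.corrAct_mem_of_primeCycle hX hX l _ ⟨Z'', hZ''⟩ c fun z hz0 hz ↦ ?_
      have hd : Order.height ((snd X X).left.base z) ≤ (d : ℕ∞) := hW.2.1 _ (hZ''W z hz0)
      exact G.corrAct_primeCycle_mem_supportedClasses_one_of_height_snd_lt hX z hz (hZ'' z hz0)
        (lt_of_le_of_lt hd (by exact_mod_cast hdl)) c
  have hm0 : (m : ℂ) ≠ 0 := by exact_mod_cast hm.ne'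
  rwa [Submodule.smul_mem_iff _ hm0] at hmem

/-- The same from the `∃ W` form `HasChowZeroSupportedInDimLE X d`, granted `G`: `N¹ Hˡ = Hˡ` for every
`l > d`. [cite: BlochSrinivas1983, Thm. 1 (proof)] [cite: VoisinHodgeII2003, Thm. 10.17 and Cor. 10.21] -/
theorem GysinFormalism.supportedClasses_eq_top_of_hasChowZeroSupportedInDimLE_of_lt (G : GysinFormalism)
    (hX : IsSmoothProjective n X) {d : ℕ} (hW : HasChowZeroSupportedInDimLE X d) {l : ℕ}
    (hdl : d < l) : supportedClasses X l 1 = ⊤ := by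
  obtain ⟨W, hW⟩ := hW
  exact G.supportedClasses_eq_top_of_chowZeroSupportedInDimLE_of_lt hX hW hdl

/-- **Hypothesis-free form**: for `X` smooth projective over `ℂ` with `CH₀(X)` supported on a closed
algebraic subset of dimension `≤ d`, `N¹ Hˡ(X(ℂ); ℂ) = Hˡ(X(ℂ); ℂ)` for every `l > d` — the formalism
`G` being supplied by the complex orientations
(`exists_gysinFormalism_isGysinHodgeCompatible_complexOrientation_holds`). [cite: BlochSrinivas1983, Thm. 1 (proof)]
[cite: VoisinHodgeII2003, Thm. 10.17, Cor. 10.21 and Thm. 1.22] -/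
theorem supportedClasses_eq_top_of_hasChowZeroSupportedInDimLE_of_lt (hX : IsSmoothProjective n X)
    {d : ℕ} (hW : HasChowZeroSupportedInDimLE X d) {l : ℕ} (hdl : d < l) :
    supportedClasses X l 1 = ⊤ := by
  obtain ⟨G, -⟩ := exists_gysinFormalism_isGysinHodgeCompatible_complexOrientation_holds
  exact G.supportedClasses_eq_top_of_hasChowZeroSupportedInDimLE_of_lt hX hW hdl

/-- **Threefolds whose `CH₀` is supported on a surface have `H³ = N¹H³`** (the known regime of
Grothendieck's amended generalised Hodge conjecture GHC(3,1): e.g. uniruled threefolds, once their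
`CH₀` is moved onto an ample surface). [cite: BlochSrinivas1983, Thm. 1 (proof)]
[cite: VoisinHodgeII2003, Thm. 10.17 and Cor. 10.21] [cite: GrothendieckTopology1969, §1] -/
theorem supportedClasses_three_one_eq_top_of_hasChowZeroSupportedInDimLE_two {Y : SchemeOver ℂ}
    (hY : IsSmoothProjective 3 Y) (hW : HasChowZeroSupportedInDimLE Y 2) :
    supportedClasses Y 3 1 = ⊤ :=
  supportedClasses_eq_top_of_hasChowZeroSupportedInDimLE_of_lt hY hW (by norm_num)

end HodgeTheory

end Literature.AlgebraicGeometry.HodgeTheory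

end
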